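import Summits.AtomisticToContinuum.Crystallization.Theorems.FrustratedLawDichotomyStrainedPatchHomEntryGramHcp
import Summits.AtomisticToContinuum.Crystallization.Theorems.FrustratedLawDichotomyStrainedPatchHomPrunesSpread
import Summits.AtomisticToContinuum.Crystallization.Theorems.FrustratedLawDichotomyTwoShellRigidityAssemblyDial
import Literature.Geometry.DiscreteGeometry.LayerShellPatterns

/-!
# The hcp kissing pattern IN THE HEXAGONAL FRAME: an explicit isometry `cuboctahedral → (hexFrame, hcpShift)` coordinates, the twelve
# labels, and the lattice form of the twelve neighbours — the dictionary for the reflected hcp (P1) fit prune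

decomp-a2c hand-2 g22 (crux `AperiodicFrustratedLawGap`, stmt-AtomisticToContinuum-27623; critic row 828 (B) «hcp analogue GO»).  The reflected (P1)
prune for the hcp family (`…HomPruned.pruneHcp_of_centre_good` + `…HomPrunesFit.goodAtScale_centre_of_fit_hcpPattern`) needs an isometry `A` carrying the
Literature pattern `hcpKissingPattern` (anticuboctahedron in cuboctahedron coordinates, `hcpTuple k = (√18)⁻¹ • hcpVec k`) onto the twelve neighbours of an
`A`-site of the ideal hcp crystal written in the tree's `hexFrame` / `hcpShift`:

* §1 `√(2/3) = √2√3/3`, `√(8/3) = 2√2√3/3` (`√18 = 3√2` is Literature `sqrt_eighteen_eq`); the orthonormal frame `hcpCol` (columns of `A`: the cuboctahedral `(1,1,1)/√3` axis ↦ `e₃`, the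
  hexagonal layer `x+y+z=0` ↦ the `xy`-plane, with the in-plane half-turn that sends the pattern's upper triangle to the `B` positions `hcpShift − {0, f₀, f₁}`);
* §2 the labels `hlab : Fin 12 → ℤ³`, the sublattice flags `hshift : Fin 12 → Bool` (six in-plane `A` neighbours `±f₀, ±f₁, ±(f₀−f₁)`, three `B` neighbours
  above `t, t−f₀, t−f₁`, three below `t−f₂, t−f₂−f₀, t−f₂−f₁`, `t = hcpShift`), the ideal neighbours `nbr k = Σ hlab k i • fᵢ (+ t)`, and
  ★ `sum_hcpTuple_smul_hcpCol : Σᵢ (hcpTuple k)ᵢ • hcpCol i = nbr k` (36 coordinate identities in `ℚ(√2, √3)`);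
* §3 ★★ `exists_hcpIso : ∃ A : E3 →ₗᵢ[ℝ] E3, ∀ k, A (hcpTuple k) = nbr k` (via hand-2 g20's `exists_linearIsometry_of_orthonormal`; `hcpTuple_injective`,
  `hcpTuple_mem`, `exists_hcpTuple_eq` are the tree's), and the DEFORMED neighbours `nbrU U ξ k = latPt U hexFrame (hlab k) (+ U (hcpShift + ξ))` with their membership in the hcp displacement family
  `{latPt U hexFrame b} ∪ {latPt U hexFrame b + U (hcpShift + ξ)}` and `nbrU 1 0 k = nbr k`.

What remains for the hcp fit verdict `fitOKH` (successor): the real theorem `goodAtScale_of_fitBounds_hcp` (copy of `…HomEntryFit.goodAtScale_of_fitBounds` with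
`t' u := nbrU U ξ k(u)`, `A` from `exists_hcpIso`, index boxes `…HomLatticeBoxHcp.mem_box_of_norm_hexPt(_add_shift)_lt`) and the kernel checks over the extended
Gram data `…HomEntryGramHcp.extFI` of `U` and of `V = U − λ·1` (misfit `≤ 2ρ + 2λ‖ξ‖`).  0 sorry; standard axioms; no instances / notation.
`--supports stmt-AtomisticToContinuum-27623`.
-/

noncomputable section

namespace Summit.AtomisticToContinuum.Crystallization.Theorems.FrustratedLawDichotomyStrainedPatchHomEntryHcpFrame

open scoped BigOperators RealInnerProductSpace
open Literature.Geometry.DiscreteGeometry (hcpKissingPattern intVec intVec_apply sqrt_eighteen_eq)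
open Literature.Geometry.DiscreteGeometry.ShellCensus (hcpTuple hcpVec)
open Summit.AtomisticToContinuum.Crystallization.Theorems.FrustratedLawDichotomyTwoShellRigidityAssemblyDial (hcpTuple_mem exists_hcpTuple_eq)
open Summit.AtomisticToContinuum.Crystallization.Theorems.ChargedEnergyGapNegative (E3)
open Summit.AtomisticToContinuum.Crystallization.Theorems.FrustratedLawDichotomyStrainedPatchHomSplit
open Summit.AtomisticToContinuum.Crystallization.Theorems.FrustratedLawDichotomyStrainedPatchHomPrunesSpread (orthonormal_of_inner exists_linearIsometry_of_orthonormal)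

/-! ## §1. Square-root bookkeeping and the orthonormal frame -/

/-- `√(2/3) = √2 √3 / 3`. [formal bookkeeping] -/
theorem sqrt23 : Real.sqrt (2 / 3) = Real.sqrt 2 * Real.sqrt 3 / 3 := by
  rw [Real.sqrt_div' _ (by norm_num : (0 : ℝ) ≤ 3)]
  have h3 : Real.sqrt 3 * Real.sqrt 3 = 3 := Real.mul_self_sqrt (by norm_num)
  have h3' : Real.sqrt 3 ≠ 0 := by positivity
  field_simp
  linarith [h3]

/-- `√(8/3) = 2 √2 √3 / 3`. [formal bookkeeping] -/
theorem sqrt83 : Real.sqrt (8 / 3) = 2 * Real.sqrt 2 * Real.sqrt 3 / 3 := by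
  rw [show (8 : ℝ) / 3 = 2 ^ 2 * (2 / 3) by norm_num, Real.sqrt_mul (by norm_num), Real.sqrt_sq (by norm_num), sqrt23]; ring

/-- ★ The columns of the isometry (images of `e₀, e₁, e₂`): `A v = (−⟨v,(1,−1,0)⟩/√2, −⟨v,(1,1,−2)⟩/√6, ⟨v,(1,1,1)⟩/√3)`. -/
def hcpCol : Fin 3 → E3 :=
  ![!₂[-(Real.sqrt 2 / 2), -(Real.sqrt 2 * Real.sqrt 3 / 6), Real.sqrt 3 / 3],
    !₂[Real.sqrt 2 / 2, -(Real.sqrt 2 * Real.sqrt 3 / 6), Real.sqrt 3 / 3],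
    !₂[0, Real.sqrt 2 * Real.sqrt 3 / 3, Real.sqrt 3 / 3]]

/-- `hcpCol` is orthonormal. [folklore] -/
theorem hcpCol_orthonormal : Orthonormal ℝ hcpCol := by
  have h2 : Real.sqrt 2 * Real.sqrt 2 = 2 := Real.mul_self_sqrt (by norm_num)
  have h3 : Real.sqrt 3 * Real.sqrt 3 = 3 := Real.mul_self_sqrt (by norm_num)
  refine orthonormal_of_inner fun i j => ?_
  fin_cases i <;> fin_cases j <;>
    simp only [PiLp.inner_apply, RCLike.inner_apply, conj_trivial, Fin.sum_univ_three] <;>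
    simp [hcpCol] <;> nlinarith [h2, h3]

/-! ## §2. Labels, sublattice flags, ideal neighbours -/

/-- Labels of the twelve hcp neighbours in the hexagonal frame, indexed like `hcpVec` / `hcpTuple`. -/
def hlab : Fin 12 → Fin 3 → ℤ :=
  ![![-1, 0, 0], ![1, 0, 0], ![0, -1, 0], ![0, 1, 0], ![1, -1, 0], ![-1, 1, 0],
    ![0, -1, 0], ![-1, 0, 0], ![0, 0, 0], ![0, -1, -1], ![-1, 0, -1], ![0, 0, -1]]

/-- Sublattice flag: `true` for the six `B`-layer neighbours (shifted by `hcpShift`), `false` for the six in-plane `A` neighbours. -/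
def hshift : Fin 12 → Bool := ![false, false, false, false, false, false, true, true, true, true, true, true]

/-- The ideal neighbour `k`: `Σᵢ hlab k i • fᵢ`, plus `hcpShift` on the `B` sublattice. -/
def nbr (k : Fin 12) : E3 := (∑ i : Fin 3, ((hlab k i : ℤ) : ℝ) • hexFrame i) + if hshift k then hcpShift else 0

/-- ★ **The pattern in the hexagonal frame**: `Σᵢ (hcpTuple k)ᵢ • hcpCol i = nbr k` for all twelve `k`. [folklore] -/
theorem sum_hcpTuple_smul_hcpCol (k : Fin 12) : ∑ i : Fin 3, (hcpTuple k) i • hcpCol i = nbr k := by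
  have h2 : Real.sqrt 2 * Real.sqrt 2 = 2 := Real.mul_self_sqrt (by norm_num)
  have h3 : Real.sqrt 3 * Real.sqrt 3 = 3 := Real.mul_self_sqrt (by norm_num)
  have h2' : Real.sqrt 2 ≠ 0 := by positivity
  have h3' : Real.sqrt 3 ≠ 0 := by positivity
  ext a
  fin_cases k <;> fin_cases a <;>
    simp only [hcpTuple, hcpCol, nbr, hlab, hshift, hexFrame, hcpShift, hcpVec, Nat.cast_ofNat, sqrt_eighteen_eq, sqrt23, sqrt83] <;>
    simp [Fin.sum_univ_three] <;> field_simp <;> nlinarith [h2, h3]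

/-! ## §3. The isometry, injectivity, and the deformed neighbours -/

/-- ★★ **THE ISOMETRY**: a linear isometry carrying the Literature hcp pattern onto the hexagonal-frame neighbours. [folklore] -/
theorem exists_hcpIso : ∃ A : E3 →ₗᵢ[ℝ] E3, ∀ k : Fin 12, A (hcpTuple k) = nbr k := by
  obtain ⟨A, hA⟩ := exists_linearIsometry_of_orthonormal hcpCol_orthonormal
  exact ⟨A, fun k => by rw [hA, sum_hcpTuple_smul_hcpCol]⟩

/-- ‖nbr k‖ = 1 (the neighbours are unit vectors, being isometric images of the pattern). [folklore] -/
theorem norm_nbr (k : Fin 12) : ‖nbr k‖ = 1 := by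
  obtain ⟨A, hA⟩ := exists_hcpIso
  rw [← hA k, LinearIsometry.norm_map]
  exact Literature.Geometry.DiscreteGeometry.norm_eq_one_of_mem_hcpKissingPattern (hcpTuple_mem k)

/-- The DEFORMED neighbour `k` of the `A`-site at the origin of the configuration `U·(L_A ∪ (L_A + hcpShift + ξ))`. -/
def nbrU (U : E3 →L[ℝ] E3) (ξ : E3) (k : Fin 12) : E3 := latPt U hexFrame (hlab k) + if hshift k then U (hcpShift + ξ) else 0

/-- `nbrU` lies in the hcp displacement family. [formal bookkeeping] -/
theorem nbrU_mem (U : E3 →L[ℝ] E3) (ξ : E3) (k : Fin 12) :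
    nbrU U ξ k ∈ {v : E3 | ∃ b : Fin 3 → ℤ, v = latPt U hexFrame b ∨ v = latPt U hexFrame b + U (hcpShift + ξ)} := by
  refine ⟨hlab k, ?_⟩
  unfold nbrU
  cases hshift k
  · left; simp
  · right; simp

/-- The unshifted form: `hshift k = false ⟹ nbrU U ξ k = latPt U hexFrame (hlab k)`. [formal bookkeeping] -/
theorem nbrU_of_unshifted {U : E3 →L[ℝ] E3} {ξ : E3} {k : Fin 12} (h : hshift k = false) : nbrU U ξ k = latPt U hexFrame (hlab k) := by
  simp [nbrU, h]

/-- The shifted form: `hshift k = true ⟹ nbrU U ξ k = latPt U hexFrame (hlab k) + U (hcpShift + ξ)`. [formal bookkeeping] -/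
theorem nbrU_of_shifted {U : E3 →L[ℝ] E3} {ξ : E3} {k : Fin 12} (h : hshift k = true) :
    nbrU U ξ k = latPt U hexFrame (hlab k) + U (hcpShift + ξ) := by
  simp [nbrU, h]

/-- At the identity and zero shuffle the deformed neighbours are the ideal ones: `nbrU 1 0 k = nbr k`. [formal bookkeeping] -/
theorem nbrU_one_zero (k : Fin 12) : nbrU 1 0 k = nbr k := by
  simp [nbrU, nbr, latPt]

/-- ★ `nbrU U ξ k = U (nbr k) + (U ξ on the B sublattice)`: the deformation acts linearly on the ideal neighbour, the shuffle moves only the `B` layer.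
[folklore] -/
theorem nbrU_eq (U : E3 →L[ℝ] E3) (ξ : E3) (k : Fin 12) : nbrU U ξ k = U (nbr k) + if hshift k then U ξ else 0 := by
  unfold nbrU nbr latPt
  cases hshift k
  · simp
  · simp [map_add]; abel

end Summit.AtomisticToContinuum.Crystallization.Theorems.FrustratedLawDichotomyStrainedPatchHomEntryHcpFrame

end
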